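import Summits.BirchSwinnertonDyer.BirchSwinnertonDyer.Theorems.ThetaPartnerAtTwoSignedMainConjectureCMTwoRankZeroPTDeepTransferTools
import Summits.BirchSwinnertonDyer.BirchSwinnertonDyer.Theorems.ResidualThetaTransportAtTwoResidualSignedLambdaLowerCMAtTwoRhoLayerPairingCompat
import Summits.BirchSwinnertonDyer.BirchSwinnertonDyer.Theorems.ResidualThetaTransportAtTwoResidualSignedLambdaLowerCMAtTwoCoindShapiroOfFun
import Literature.NumberTheory.EllipticCurves.CyclotomicLayerRhoTatePairingPk
import Literature.NumberTheory.EllipticCurves.GreenbergVatsal2000.ResidualSelmerGroups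
import Literature.NumberTheory.EllipticCurves.CyclotomicZpExtensionLocalGeneratorProofs
import Literature.NumberTheory.EllipticCurves.IwasawaSelmerProofs
import Literature.NumberTheory.EllipticCurves.PeriodIndexCorestrictionLocal
import HarnessLib

/-!
# Stub-ideation k2·g15 — `stub_cmLambdaLower` (= RSL_g `ResidualSignedLambdaLowerCMAtTwo`, stmt-BirchSwinnertonDyer-22608),
# crux (R≥)ᵖ `ResidualThetaCountLowerPureAtTwo` (stmt-BirchSwinnertonDyer-26074), skeleton `Lines/bt26_lambda.lean` v6.

TECHNIQUE (family 1, literature transfer — used as 1(c) ANALOGY TRANSFER with a typed dictionary): TP2's W-side (E)-socket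
`SignedLowerOffTwo.PTDeep.levelwisePoitouTate_of_transfer` (`…PTDeepSelmerSocket.lean`, ll. 160–374) is PORTED to
`ρ`-coefficients `A_ρ = Cofree ρ F` read through the frame `Θ : A_ρ ≃+ E[p^∞]^r` (Greenberg 1989 §1) and the Θ-transported layer
Kummer map `CyclotomicLayer.thetaLayerKummer` (Kobayashi 2003 §2 p. 4, (8.23) p. 18), on top of the LANDED `ρM`-generic dictionary
`Theorems.ThetaTransport.CoindShapiroOfFun` §1–§3.

HONEST FRAMING.  Theorems only, 0 `sorry`, generic prime `p`, generic sign `ε`, generic `Θ` at one place `v`; nothing here proves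
RSL_g, (R≥)ᵖ, R≥ or BSD — BSD is NOT proved by any of this.  §1–§5 (the Kummer-witness transport T3♮) were typed independently
but k3·g14 (`Ideas/stub-cmlambdalower-k3-g14.md`, `Sketch_sidea_k3_g14.lean`, filed 03:27Z) PROVED THE SAME CHAIN FIRST — they are
kept here only as the consumer of §7 in §8; NO credit is claimed for them.  The card's content is §6–§8:

  «[kum] is OUTPUT, not input»: in the S4₂ levelwise-existence socket typed TP2-style (`𝓕_v := C^⊥`,
  `C := T_v (layerShapiroOf (thetaLayerKummer (E⁺_n)^r))`, `𝓖_v := ⊤`), the generic one-place character lift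
  `LocalInvariants.exists_selmer_canonical_localTatePairing_eq_of_subgroup` hands every dual Selmer class `y` together with
  `hy : loc_v y ∈ C` (double annihilator on the FINITE local groups of `Maps(Γ_ℚ ⧸ Γ_n, A_ρ[p^k])`); §6–§7 turn `hy` into
  `y = H¹(Ψ)(Sh b)`, `Q ∈ (E⁺_n)^r`, `layerLocOf b = thetaLayerKummer Q` (= the hypothesis `[kum]_n` of T3♮), and §8 composes with
  T3♮ to RSL_g's clause (3) (signed, every `σ`) for `transferH1 b`.  No «points^⊥ = points» self-duality of signed points is used.

DICTIONARY (W-side TP2 ↦ ρ-side here / landed):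
* `A.torsionGaloisModule ((2^k:ℕ):ℤ)`, `weilTowerPk A k`  ↦ `cofreeTorsionGaloisModule S ρ ((p^k:ℕ):ℤ)`, a non-degenerate pairing `e` on `A_ρ[p^k]` (binder)
* `layerLoc / layerShapiro / layerKummer A (2^k) κ v n`   ↦ `layerLocOf / layerShapiroOf ρM κ v n` / `thetaLayerKummer S ρ k W Θ κ v hΘ n`
* socket ll. 163–164 `exists_injective_dualTransport A …` ↦ `CoindShapiroOfFun.exists_injective_dualTransport ρM …` (landed; here the binders `T`, `hT`)
* socket ll. 289–291 `existsUnique_shapiroLift_coindTateDual_eq A …` ↦ same name in `CoindShapiroOfFun` (landed; used in §7)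
* socket ll. 353–364 (the `hkum` block)                  ↦ §6 `layerShapiroOf_layerLocOf_eq_of_localization_eq_dualTransport`, `layerLocOf_eq_of_localization_eq_dualTransport`
* socket ll. 293–295 (`hyC` unpacking, `C = fE.range`)    ↦ §7 `exists_shapiroLift_eq_and_layerLocOf_eq_thetaLayerKummer`
* socket l. 366 brick `hm₀ … hkum` ((T) of TransferTools) ↦ §8 ∘ (T1/T2 of `Theorems.ThetaTransport.CofreeSelmerTransfer`) ∘ S4₂'s hypothesis ∘ `DeepHalfValueTransfer`
* push `E[p^k] ↪ E[p^∞]`, then `layerToInfty`            ↦ `transferH1 S ρ κ (p^k) n = resOfLe ∘ pushH1 (A_ρ[p^k] ↪ A_ρ)` (k3·g13's term, copied in §0)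
* `Γ_v`-equivariance of coefficients                      ↦ the frame hypothesis `hΘ` (Θ is `Γ_v`-equivariant along `θ = resGalOfEmb ι`).

CONTENTS: §0 `transferH1` · §1–§5 T3♮ chain (replication of k3·g14, consumer only) · §6 socket readback (ρM-generic) · §7 dual-side
dictionary, Kummer part (`M := A_ρ[p^k]`) · §8 end to end: `loc_v y ∈ C` ⟹ clause (3) signed ∀σ for `transferH1 b`, `y = H¹(Ψ)(Sh b)`.
-/
noncomputable section

open scoped Classical NumberField

namespace Summit.BirchSwinnertonDyer.BirchSwinnertonDyer.Cruxes.ResidualThetaCountLowerPureAtTwo.StubIdeasK2G15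

open CategoryTheory Field IsDedekindDomain NumberField
  Literature.NumberTheory.EllipticCurves Literature.NumberTheory.GaloisRepresentations
  Literature.NumberTheory.GaloisRepresentations.DiscreteGaloisModule
  Literature.NumberTheory.EllipticCurves.GreenbergSelmer Literature.NumberTheory.EllipticCurves.GreenbergVatsal2000
  Literature.NumberTheory.EllipticCurves.Kobayashi2003 Literature.NumberTheory.EllipticCurves.CyclotomicLayer
  Literature.NumberTheory.GaloisCohomology ZpExtension _root_.WeierstrassCurve
  Summit.BirchSwinnertonDyer.BirchSwinnertonDyer.Theorems
  Summit.BirchSwinnertonDyer.BirchSwinnertonDyer.Theorems.SignedLowerOffTwo.PTDeep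

variable {p : ℕ} [Fact p.Prime] (S : Set (PadicAlgCl p)) {d : ℕ} (ρ : FramedGaloisRep ℚ ↥(padicCoeffIntegers S) d)
  (κ : ZpExtension ℚ p)

/-! ## §0 The transfer map `τ_{n,N} = res_{Γ_∞ ≤ Γ_n} ∘ (A_ρ[N] ↪ A_ρ)_*` (verbatim k3·g13 §1, so the port is by name) -/

section Transfer

variable (N : ℤ) (n : ℕ)

/-- The inclusion `A_ρ[N] ↪ A_ρ` is `Γ_ℚ`-equivariant. [cite: SerreGaloisCohomology1997, I §2.1] -/
theorem torsionBy_subtype_smul (g : absoluteGaloisGroup ℚ) (x : ↥(AddSubgroup.torsionBy (Cofree ρ ↥(padicCoeffField S)) N)) :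
    (AddSubgroup.torsionBy (Cofree ρ ↥(padicCoeffField S)) N).subtype (g • x) =
      g • (AddSubgroup.torsionBy (Cofree ρ ↥(padicCoeffField S)) N).subtype x :=
  rfl

/-- **`τ_{n,N} : H¹(Γ_n, A_ρ[N]) → H¹(Γ_∞, A_ρ)`** — push along `A_ρ[N] ↪ A_ρ`, then restrict to `Γ_∞ = ker κ`.
[cite: PerrinRiou1994Asterisque229, §1.3] [cite: NeukirchSchmidtWingberg2008, I §5] -/
abbrev transferH1 : subgroupH1 (κ.layerSubgroup n) ↥(AddSubgroup.torsionBy (Cofree ρ ↥(padicCoeffField S)) N) →+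
    subgroupH1 κ.kerSubgroup (Cofree ρ ↥(padicCoeffField S)) :=
  (resOfLe (Cofree ρ ↥(padicCoeffField S)) (κ.kerSubgroup_le_layerSubgroup n)).comp
    (pushH1 (κ.layerSubgroup n) (AddSubgroup.torsionBy (Cofree ρ ↥(padicCoeffField S)) N).subtype
      (torsionBy_subtype_smul S ρ N))

end Transfer

variable (k : ℕ) (W : WeierstrassCurve ℚ) [W.IsElliptic] {r : ℕ}
  (Θ : Cofree ρ ↥(padicCoeffField S) ≃+ (Fin r → ↥(W.geomPrimaryTorsion p)))
  (v : HeightOneSpectrum (𝓞 ℚ))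
  (hΘ : ∀ (δ : absoluteGaloisGroup (v.adicCompletion ℚ)) (m : Cofree ρ ↥(padicCoeffField S)) (i : Fin r),
    Θ (resGalOfEmb (closureEmb (K := ℚ) (v.adicCompletion ℚ)) δ • m) i =
      resGalOfEmb (closureEmb (K := ℚ) (v.adicCompletion ℚ)) δ • Θ m i)

/-! ## §1 L-A: a Θ-Kummer witness at layer `n` from the socket equation `[kum]`
(twin of TP2 `exists_kummerWitness_push_of_layerLoc_eq_layerKummer`) -/

set_option maxHeartbeats 800000 in
include hΘ in
/-- **L-A (the transport).**  If the localisation `loc_n b ∈ H¹(U_n, A_ρ[p^k]|)` of a level class `b ∈ H¹(Γ_n, A_ρ[p^k])`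
is the Θ-Kummer class `thetaLayerKummer Q = Σ_i Θ⁻¹(κ_{U_n}(Q_i)·δ_i)` of a tuple `Q ∈ E(ℚ_{n,v})^r`, then the push of `b`
to `H¹(Γ_n, A_ρ)` has a cocycle `φ` and points `R_i` with `p^k R_i = Q_i` and `ι_*(Θ(φ(res τ))_i) = τR_i − R_i` on `U_n`:
two cocycles with the same class differ by the coboundary of some `t ∈ A_ρ[p^k]`, and `R_i := Q'_i + ι_*(Θ(t)_i)` with
`p^k Q'_i = Q_i` (`E(ℚ̄_v)` divisible) absorbs it (`p^k Θ(t)_i = 0`).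
[cite: Kobayashi2003, §2 (p. 4), (8.23) (p. 18)] [cite: Greenberg1989, §1 p. 98] [cite: SilvermanAEC2009, VIII §2] -/
theorem exists_thetaKummerWitness_pushH1_of_layerLocOf_eq_thetaLayerKummer (n : ℕ)
    (b : subgroupH1 (κ.layerSubgroup n) ↥(AddSubgroup.torsionBy (Cofree ρ ↥(padicCoeffField S)) ((p ^ k : ℕ) : ℤ)))
    (Q : Fin r → ↥(localLayerPointsOfEmb κ (closureEmb (K := ℚ) (v.adicCompletion ℚ)) W n))
    (hkum : layerLocOf (cofreeTorsionGaloisModule S ρ ((p ^ k : ℕ) : ℤ)) κ v n b =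
      thetaLayerKummer S ρ k W Θ κ v hΘ n Q) :
    ∃ (φ : contOneCocycles (discreteTopRep (κ.layerSubgroup n) (Cofree ρ ↥(padicCoeffField S))))
      (R : Fin r → localPoints W (v.adicCompletion ℚ)),
      oneCocycleClass _ φ =
          pushH1 (κ.layerSubgroup n) (AddSubgroup.torsionBy (Cofree ρ ↥(padicCoeffField S)) ((p ^ k : ℕ) : ℤ)).subtype
            (torsionBy_subtype_smul S ρ _) b ∧
        (∀ i, (p ^ k) • R i =
          ((Q i : ↥(localLayerPointsOfEmb κ (closureEmb (K := ℚ) (v.adicCompletion ℚ)) W n)) :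
            localPoints W (v.adicCompletion ℚ))) ∧
        ∀ (τ : layerGroup κ v n) (i : Fin r),
          pointsMapOfEmb W (closureEmb (K := ℚ) (v.adicCompletion ℚ))
            ((Θ (φ.1 (resGalSubgroupOfEmb (κ.layerSubgroup n) (closureEmb (K := ℚ) (v.adicCompletion ℚ)) τ)) i :
              ↥(W.geomPrimaryTorsion p)) : W.geomPoints) =
            (τ : absoluteGaloisGroup (v.adicCompletion ℚ)) • R i - R i := by
  have hN : ((p ^ k : ℕ) : ℤ) ≠ 0 := by exact_mod_cast NeZero.ne (p ^ k)
  -- a representative of `b`, read in the `subgroupRep (cofreeTorsionGaloisModule …).toTopRep` dialect (`rfl` bridge)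
  obtain ⟨β, hβ⟩ := oneCocycleClass_surjective
    (subgroupRep (cofreeTorsionGaloisModule S ρ ((p ^ k : ℕ) : ℤ)).toTopRep (κ.layerSubgroup n)) b
  -- `p^k`-th roots `Q'_i` of the `Q_i` (`E(ℚ̄_v)` is divisible)
  obtain ⟨Q', hR⟩ : ∃ Q' : Fin r → localPoints W (v.adicCompletion ℚ), ∀ i, ((p ^ k : ℕ) : ℤ) • Q' i =
      ((Q i : ↥(localLayerPointsOfEmb κ (closureEmb (K := ℚ) (v.adicCompletion ℚ)) W n)) :
        localPoints W (v.adicCompletion ℚ)) :=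
    ⟨fun i ↦ W.subgroupZSMulRoot ((p ^ k : ℕ) : ℤ) hN _, fun i ↦ W.zsmul_subgroupZSMulRoot _ hN _⟩
  have hfix : ∀ i, ((p ^ k : ℕ) : ℤ) • Q' i ∈
      FixedPoints.addSubgroup (layerGroup κ v n) (localPoints W (v.adicCompletion ℚ)) := fun i ↦ by
    rw [hR]; exact (Q i).2
  -- the Θ-Kummer class of `Q` as ONE explicit cocycle `ψ = Σ_i Θ⁻¹(kc_i · δ_i)`, `kc_i` the Kummer cocycle of `Q'_i` on `U_n`
  obtain ⟨ψ, hψ⟩ : ∃ ψ : contOneCocycles (subgroupRep (cofreeTorsionLocalRep S ρ ((p ^ k : ℕ) : ℤ) v) (layerGroup κ v n)),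
      ψ = ∑ i, contOneCocycles.pushAddHom (thetaSingle ρ p k W Θ i) continuous_of_discreteTopology
        (thetaSingle_subgroupRep S ρ k W Θ κ v hΘ i n)
        (W.subgroupKummerCocycle ((p ^ k : ℕ) : ℤ) (layerGroup κ v n) hN (Q' i) (hfix i)) := ⟨_, rfl⟩
  have hK : thetaLayerKummer S ρ k W Θ κ v hΘ n Q = oneCocycleClass _ ψ := by
    have hKi : ∀ i, layerKummer W (p ^ k) κ v n (Q i) =
        oneCocycleClass (subgroupRep (torsionLocalRep W (p ^ k) v) (layerGroup κ v n))
          (W.subgroupKummerCocycle ((p ^ k : ℕ) : ℤ) (layerGroup κ v n) hN (Q' i) (hfix i)) := fun i ↦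
      W.subgroupKummerMap_apply_eq ((p ^ k : ℕ) : ℤ) (layerGroup κ v n) hN (Q i) (Q' i) (hfix i) (hR i)
    rw [thetaLayerKummer_apply, hψ]
    simp_rw [hKi, thetaSingleH1_oneCocycleClass, ← oneCocycleClassₗ_apply, ← map_sum]
  -- `loc_n b = [β ∘ res]`
  have hL : layerLocOf (cofreeTorsionGaloisModule S ρ ((p ^ k : ℕ) : ℤ)) κ v n b =
      oneCocycleClass (subgroupRep (cofreeTorsionLocalRep S ρ ((p ^ k : ℕ) : ℤ) v) (layerGroup κ v n))
        (contOneCocycles.pullback (resGalSubgroupOfEmb (κ.layerSubgroup n) (closureEmb (K := ℚ) (v.adicCompletion ℚ)))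
          (X := subgroupRep (cofreeTorsionGaloisModule S ρ ((p ^ k : ℕ) : ℤ)).toTopRep (κ.layerSubgroup n))
          (Y := subgroupRep (cofreeTorsionLocalRep S ρ ((p ^ k : ℕ) : ℤ) v) (layerGroup κ v n))
          (TopRep.ofHom ⟨ContinuousLinearMap.id ℤ _, fun _ ↦ rfl⟩) β) := by
    rw [← hβ]
    exact ThetaTransport.layerLocOf_oneCocycleClass v (cofreeTorsionGaloisModule S ρ ((p ^ k : ℕ) : ℤ)) κ n β
  -- the difference of the two cocycles is a coboundary `∂t`
  have hdiff : oneCocycleClass (subgroupRep (cofreeTorsionLocalRep S ρ ((p ^ k : ℕ) : ℤ) v) (layerGroup κ v n))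
      (contOneCocycles.pullback (resGalSubgroupOfEmb (κ.layerSubgroup n) (closureEmb (K := ℚ) (v.adicCompletion ℚ)))
          (X := subgroupRep (cofreeTorsionGaloisModule S ρ ((p ^ k : ℕ) : ℤ)).toTopRep (κ.layerSubgroup n))
          (Y := subgroupRep (cofreeTorsionLocalRep S ρ ((p ^ k : ℕ) : ℤ) v) (layerGroup κ v n))
          (TopRep.ofHom ⟨ContinuousLinearMap.id ℤ _, fun _ ↦ rfl⟩) β - ψ) = 0 := by
    rw [oneCocycleClass_sub, ← hK, ← hL, sub_eq_zero]
    exact hkum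
  rw [oneCocycleClass_eq_zero_iff] at hdiff
  obtain ⟨t, ht⟩ := hdiff
  -- values: `ι_*(Θ(β(res τ))_i) = (τQ'_i − Q'_i) + (τ ι_*Θ(t)_i − ι_*Θ(t)_i)`
  have hval : ∀ (τ : layerGroup κ v n) (i : Fin r),
      pointsMapOfEmb W (closureEmb (K := ℚ) (v.adicCompletion ℚ))
        ((Θ ((β.1 (resGalSubgroupOfEmb (κ.layerSubgroup n) (closureEmb (K := ℚ) (v.adicCompletion ℚ)) τ) :
            ↥(AddSubgroup.torsionBy (Cofree ρ ↥(padicCoeffField S)) ((p ^ k : ℕ) : ℤ))) : Cofree ρ ↥(padicCoeffField S)) i :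
          ↥(W.geomPrimaryTorsion p)) : W.geomPoints) =
        (τ : absoluteGaloisGroup (v.adicCompletion ℚ)) •
            (Q' i + pointsMapOfEmb W (closureEmb (K := ℚ) (v.adicCompletion ℚ))
              ((Θ (t : Cofree ρ ↥(padicCoeffField S)) i : ↥(W.geomPrimaryTorsion p)) : W.geomPoints)) -
          (Q' i + pointsMapOfEmb W (closureEmb (K := ℚ) (v.adicCompletion ℚ))
              ((Θ (t : Cofree ρ ↥(padicCoeffField S)) i : ↥(W.geomPrimaryTorsion p)) : W.geomPoints)) := by
    intro τ i
    -- the coboundary equation at `τ`: `β(res τ) − ψ(τ) = θ(τ)t − t` in `A_ρ[p^k]`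
    have e1 : (((contOneCocycles.pullback (resGalSubgroupOfEmb (κ.layerSubgroup n) (closureEmb (K := ℚ) (v.adicCompletion ℚ)))
          (X := subgroupRep (cofreeTorsionGaloisModule S ρ ((p ^ k : ℕ) : ℤ)).toTopRep (κ.layerSubgroup n))
          (Y := subgroupRep (cofreeTorsionLocalRep S ρ ((p ^ k : ℕ) : ℤ) v) (layerGroup κ v n))
          (TopRep.ofHom ⟨ContinuousLinearMap.id ℤ _, fun _ ↦ rfl⟩) β - ψ).1 τ :
          ↥(AddSubgroup.torsionBy (Cofree ρ ↥(padicCoeffField S)) ((p ^ k : ℕ) : ℤ))) : Cofree ρ ↥(padicCoeffField S)) =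
        ((β.1 (resGalSubgroupOfEmb (κ.layerSubgroup n) (closureEmb (K := ℚ) (v.adicCompletion ℚ)) τ) :
            ↥(AddSubgroup.torsionBy (Cofree ρ ↥(padicCoeffField S)) ((p ^ k : ℕ) : ℤ))) : Cofree ρ ↥(padicCoeffField S)) -
          ((ψ.1 τ : ↥(AddSubgroup.torsionBy (Cofree ρ ↥(padicCoeffField S)) ((p ^ k : ℕ) : ℤ))) :
            Cofree ρ ↥(padicCoeffField S)) := rfl
    have e2 : ((((subgroupRep (cofreeTorsionLocalRep S ρ ((p ^ k : ℕ) : ℤ) v) (layerGroup κ v n)).ρ τ t -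
          t : ↥(AddSubgroup.torsionBy (Cofree ρ ↥(padicCoeffField S)) ((p ^ k : ℕ) : ℤ))) : Cofree ρ ↥(padicCoeffField S))) =
        resGalOfEmb (closureEmb (K := ℚ) (v.adicCompletion ℚ)) (τ : absoluteGaloisGroup (v.adicCompletion ℚ)) •
            (t : Cofree ρ ↥(padicCoeffField S)) - (t : Cofree ρ ↥(padicCoeffField S)) := rfl
    -- `ψ(τ) = Θ⁻¹((kc_j(τ))_j)` in `A_ρ`
    have e3 : ((ψ.1 τ : ↥(AddSubgroup.torsionBy (Cofree ρ ↥(padicCoeffField S)) ((p ^ k : ℕ) : ℤ))) :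
        Cofree ρ ↥(padicCoeffField S)) = Θ.symm (fun j ↦ AddSubgroup.inclusion (geomTorsion_natCast_pow_le_geomPrimaryTorsion p k W)
          ((W.subgroupKummerCocycle ((p ^ k : ℕ) : ℤ) (layerGroup κ v n) hN (Q' j) (hfix j)).1 τ)) := by
      rw [← sum_thetaSingle ρ p k W Θ, hψ, Submodule.coe_sum, ContinuousMap.sum_apply, AddSubmonoidClass.coe_finsetSum]
      rfl
    have h := congrArg (fun x : ↥(AddSubgroup.torsionBy (Cofree ρ ↥(padicCoeffField S)) ((p ^ k : ℕ) : ℤ)) ↦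
      (x : Cofree ρ ↥(padicCoeffField S))) (ht τ)
    dsimp only at h
    rw [e1, e2, e3, sub_eq_iff_eq_add] at h
    -- the Kummer cocycles' values on points
    have hkc : pointsMapOfEmb W (closureEmb (K := ℚ) (v.adicCompletion ℚ))
        (((W.subgroupKummerCocycle ((p ^ k : ℕ) : ℤ) (layerGroup κ v n) hN (Q' i) (hfix i)).1 τ :
          geomTorsion W ((p ^ k : ℕ) : ℤ)) : W.geomPoints) =
          (τ : absoluteGaloisGroup (v.adicCompletion ℚ)) • Q' i - Q' i :=
      W.pointsMap_subgroupKummerCocycle_apply _ _ hN (Q' i) (hfix i) τ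
    have h3 := congrArg (fun m : Cofree ρ ↥(padicCoeffField S) ↦
      pointsMapOfEmb W (closureEmb (K := ℚ) (v.adicCompletion ℚ)) ((Θ m i : ↥(W.geomPrimaryTorsion p)) : W.geomPoints)) h
    dsimp only at h3
    rw [map_add, map_sub, AddEquiv.apply_symm_apply, Pi.add_apply, Pi.sub_apply, hΘ, AddMemClass.coe_add,
      AddSubgroupClass.coe_sub, primaryComponent.coe_smul, map_add, map_sub, pointsMapOfEmb_smul,
      AddSubgroup.coe_inclusion, hkc] at h3
    rw [h3, smul_add]
    abel
  refine ⟨contOneCocycles.pullback (ContinuousMonoidHom.id _)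
      (resHomOfEquivariant (ContinuousMonoidHom.id _)
        (AddSubgroup.torsionBy (Cofree ρ ↥(padicCoeffField S)) ((p ^ k : ℕ) : ℤ)).subtype fun _ _ ↦ rfl) β,
    fun i ↦ Q' i + pointsMapOfEmb W (closureEmb (K := ℚ) (v.adicCompletion ℚ))
      ((Θ (t : Cofree ρ ↥(padicCoeffField S)) i : ↥(W.geomPrimaryTorsion p)) : W.geomPoints), ?_, fun i ↦ ?_,
    fun τ i ↦ ?_⟩
  · rw [← hβ]
    exact (resH1Hom_oneCocycleClass _ _ _ β).symm
  · -- `p^k • (Q'_i + ι_*Θ(t)_i) = Q_i`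
    have ht0 : ((p ^ k : ℕ) : ℤ) • (t : Cofree ρ ↥(padicCoeffField S)) = 0 :=
      (Submodule.mem_torsionBy_iff ((p ^ k : ℕ) : ℤ) (t : Cofree ρ ↥(padicCoeffField S))).mp t.2
    have hΘt : (p ^ k) • ((Θ (t : Cofree ρ ↥(padicCoeffField S)) i : ↥(W.geomPrimaryTorsion p)) : W.geomPoints) = 0 := by
      rw [← AddSubgroupClass.coe_nsmul, ← Pi.smul_apply, ← map_nsmul, ← natCast_zsmul, ht0, map_zero, Pi.zero_apply,
        ZeroMemClass.coe_zero]
    rw [smul_add, ← map_nsmul, hΘt, map_zero, add_zero, ← natCast_zsmul, hR i]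
  · rw [contOneCocycles.pullback_apply]
    exact hval τ i

/-! ## §2 L-B: conjugating a Θ-Kummer witness by `θ(d)`, `d ∈ Γ_v` (twin of TP2 `kummerWitness_conj_layer`) -/

omit [W.IsElliptic] in
include hΘ in
/-- **L-B.** If `φ` (a cocycle on a normal `H ≤ Γ_ℚ` with values in `A_ρ`) satisfies the Θ-Kummer identities
`ι_*(Θ(φ(res τ))_i) = τR_i − R_i` on `H ∩ θ(Γ_v)`, then its conjugate by `θ(d)`, `d ∈ Γ_v`, satisfies them with the points
`d • R_i` (`θ(d)⁻¹ τ θ(d) = θ(d⁻¹τd)`, `Θ` and `ι_*` are `Γ_v`-equivariant). [cite: SerreGaloisCohomology1997, I §5.3] -/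
theorem thetaKummerWitness_conj (H : Subgroup (absoluteGaloisGroup ℚ)) [H.Normal]
    (d : absoluteGaloisGroup (v.adicCompletion ℚ))
    {φ : contOneCocycles (discreteTopRep H (Cofree ρ ↥(padicCoeffField S)))}
    {R : Fin r → localPoints W (v.adicCompletion ℚ)}
    (hτ : ∀ (τ : localSubgroupOfEmb H (closureEmb (K := ℚ) (v.adicCompletion ℚ))) (i : Fin r),
      pointsMapOfEmb W (closureEmb (K := ℚ) (v.adicCompletion ℚ))
        ((Θ (φ.1 (resGalSubgroupOfEmb H (closureEmb (K := ℚ) (v.adicCompletion ℚ)) τ)) i : ↥(W.geomPrimaryTorsion p)) :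
          W.geomPoints) = (τ : absoluteGaloisGroup (v.adicCompletion ℚ)) • R i - R i)
    (τ : localSubgroupOfEmb H (closureEmb (K := ℚ) (v.adicCompletion ℚ))) (i : Fin r) :
    pointsMapOfEmb W (closureEmb (K := ℚ) (v.adicCompletion ℚ))
      ((Θ ((conjCocycle H (resGalOfEmb (closureEmb (K := ℚ) (v.adicCompletion ℚ)) d) φ).1
        (resGalSubgroupOfEmb H (closureEmb (K := ℚ) (v.adicCompletion ℚ)) τ)) i : ↥(W.geomPrimaryTorsion p)) : W.geomPoints) =
      (τ : absoluteGaloisGroup (v.adicCompletion ℚ)) • (d • R i) - d • R i := by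
  have hτ' : d⁻¹ * (τ : absoluteGaloisGroup (v.adicCompletion ℚ)) * d ∈
      localSubgroupOfEmb H (closureEmb (K := ℚ) (v.adicCompletion ℚ)) := by
    rw [mem_localSubgroupOfEmb_iff, map_mul, map_mul, map_inv]
    exact Subgroup.Normal.conj_mem' inferInstance _
      ((mem_localSubgroupOfEmb_iff H (closureEmb (K := ℚ) (v.adicCompletion ℚ)) _).1 τ.2) _
  have hconj : subgroupConj H (resGalOfEmb (closureEmb (K := ℚ) (v.adicCompletion ℚ)) d)
      (resGalSubgroupOfEmb H (closureEmb (K := ℚ) (v.adicCompletion ℚ)) τ) =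
        resGalSubgroupOfEmb H (closureEmb (K := ℚ) (v.adicCompletion ℚ)) ⟨_, hτ'⟩ :=
    Subtype.ext (by simp only [subgroupConj_apply_coe, resGalSubgroupOfEmb_apply_coe, map_mul, map_inv])
  rw [conjCocycle_apply, hconj, hΘ, primaryComponent.coe_smul, pointsMapOfEmb_smul, hτ ⟨_, hτ'⟩, smul_sub, smul_smul,
    smul_smul, ← mul_assoc, ← mul_assoc, mul_inv_cancel, one_mul]

/-! ## §3 L-C: restricting a Θ-Kummer witness along `H₀ ≤ H` (twin of TP2 `layerToInfty`'s cocycle bookkeeping) -/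

/-- **L-C (class).** `res_{H₀ ≤ H} [φ] = [φ|_{H₀}]` on explicit cocycles. [cite: NeukirchSchmidtWingberg2008, I §5] -/
theorem resOfLe_oneCocycleClass {H₀ H : Subgroup (absoluteGaloisGroup ℚ)} (h : H₀ ≤ H)
    (φ : contOneCocycles (discreteTopRep H (Cofree ρ ↥(padicCoeffField S)))) :
    resOfLe (Cofree ρ ↥(padicCoeffField S)) h (oneCocycleClass _ φ) =
      oneCocycleClass (discreteTopRep H₀ (Cofree ρ ↥(padicCoeffField S)))
        (contOneCocycles.pullback (subgroupInclusion h)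
          (resHomOfEquivariant (subgroupInclusion h) (AddMonoidHom.id _) fun _ _ ↦ rfl) φ) :=
  resH1Hom_oneCocycleClass _ _ _ φ

omit [W.IsElliptic] in
/-- **L-C (values).** The restricted cocycle keeps the Θ-Kummer identities (same points) on `H₀ ∩ θ(Γ_v)`.
[cite: NeukirchSchmidtWingberg2008, I §5] -/
theorem thetaKummerWitness_resOfLe {H₀ H : Subgroup (absoluteGaloisGroup ℚ)} (h : H₀ ≤ H)
    {φ : contOneCocycles (discreteTopRep H (Cofree ρ ↥(padicCoeffField S)))}
    {R : Fin r → localPoints W (v.adicCompletion ℚ)}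
    (hτ : ∀ (τ : localSubgroupOfEmb H (closureEmb (K := ℚ) (v.adicCompletion ℚ))) (i : Fin r),
      pointsMapOfEmb W (closureEmb (K := ℚ) (v.adicCompletion ℚ))
        ((Θ (φ.1 (resGalSubgroupOfEmb H (closureEmb (K := ℚ) (v.adicCompletion ℚ)) τ)) i : ↥(W.geomPrimaryTorsion p)) :
          W.geomPoints) = (τ : absoluteGaloisGroup (v.adicCompletion ℚ)) • R i - R i)
    (τ : localSubgroupOfEmb H₀ (closureEmb (K := ℚ) (v.adicCompletion ℚ))) (i : Fin r) :
    pointsMapOfEmb W (closureEmb (K := ℚ) (v.adicCompletion ℚ))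
      ((Θ ((contOneCocycles.pullback (subgroupInclusion h)
          (resHomOfEquivariant (subgroupInclusion h) (AddMonoidHom.id _) fun _ _ ↦ rfl) φ).1
        (resGalSubgroupOfEmb H₀ (closureEmb (K := ℚ) (v.adicCompletion ℚ)) τ)) i : ↥(W.geomPrimaryTorsion p)) : W.geomPoints) =
      (τ : absoluteGaloisGroup (v.adicCompletion ℚ)) • R i - R i := by
  have e : subgroupInclusion h (resGalSubgroupOfEmb H₀ (closureEmb (K := ℚ) (v.adicCompletion ℚ)) τ) =
      resGalSubgroupOfEmb H (closureEmb (K := ℚ) (v.adicCompletion ℚ)) ⟨τ, h τ.2⟩ := Subtype.ext rfl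
  rw [contOneCocycles.pullback_apply, e]
  exact hτ ⟨τ, h τ.2⟩ i

/-! ## §4 T3♮: every conjugate of the transferred class is a Θ-Kummer class with points in any `Γ_v`-stable `B ∋ Q` -/

include hΘ in
/-- **T3♮ (the `ρ`-twin of TP2's PLUS-Kummer transport; generic `Γ_v`-stable target subgroup `B`).**
For the cyclotomic tower at `v ∣ p` and a level class `b ∈ H¹(Γ_n, A_ρ[p^k])` whose localisation is the Θ-Kummer class of
`Q ∈ E(ℚ_{n,v})^r ∩ B^r` (`[kum]`), EVERY conjugate `conj_σ (τ_{n,p^k} b)`, `σ ∈ Γ_ℚ`, has a cocycle `φ` on `Γ_∞` and points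
`R ∈ E(ℚ̄_v)^r` with `p^k R_i ∈ B` and `ι_*(Θ(φ(res τ))_i) = τR_i − R_i` on `Γ_∞ ∩ θ(Γ_v)`.
Moves: L-A (layer witness) → ONE ORBIT `σ = θ(d)·u`, `u ∈ Γ_∞` (`κ ∘ θ` is onto: `p` is totally ramified in `ℚ_∞`,
`IsCyclotomic.exists_apply_resGalOfEmb_adicCompletion_eq`), `conj_u = id` on `H¹(Γ_∞, ·)` (`conjH1_of_mem`) → L-C (restrict to
`Γ_∞`) → L-B (conjugate by `θ(d)`: points `d • R_i`, and `p^k (d • R_i) = d • Q_i ∈ B`).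
[cite: Kobayashi2003, §2 (p. 4), (8.23) (p. 18)] [cite: Washington1997, §13.1] [cite: SerreGaloisCohomology1997, I §5.3]
[cite: Greenberg1989, §1 p. 98] -/
theorem exists_thetaKummerWitness_conjH1_transferH1 (hκ : κ.IsCyclotomic) (hv : (p : 𝓞 ℚ) ∈ v.asIdeal) (n : ℕ)
    (b : subgroupH1 (κ.layerSubgroup n) ↥(AddSubgroup.torsionBy (Cofree ρ ↥(padicCoeffField S)) ((p ^ k : ℕ) : ℤ)))
    (Q : Fin r → ↥(localLayerPointsOfEmb κ (closureEmb (K := ℚ) (v.adicCompletion ℚ)) W n))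
    (hkum : layerLocOf (cofreeTorsionGaloisModule S ρ ((p ^ k : ℕ) : ℤ)) κ v n b =
      thetaLayerKummer S ρ k W Θ κ v hΘ n Q)
    (B : AddSubgroup (localPoints W (v.adicCompletion ℚ)))
    (hB : ∀ (δ : absoluteGaloisGroup (v.adicCompletion ℚ)) (a : localPoints W (v.adicCompletion ℚ)), a ∈ B → δ • a ∈ B)
    (hQB : ∀ i, ((Q i : ↥(localLayerPointsOfEmb κ (closureEmb (K := ℚ) (v.adicCompletion ℚ)) W n)) :
      localPoints W (v.adicCompletion ℚ)) ∈ B)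
    (σ : absoluteGaloisGroup ℚ) :
    ∃ (φ : contOneCocycles (discreteTopRep κ.kerSubgroup (Cofree ρ ↥(padicCoeffField S))))
      (R : Fin r → localPoints W (v.adicCompletion ℚ)) (k' : ℕ),
      oneCocycleClass _ φ =
          conjH1 κ.kerSubgroup (Cofree ρ ↥(padicCoeffField S)) σ (transferH1 S ρ κ ((p ^ k : ℕ) : ℤ) n b) ∧
        (∀ i, (p ^ k') • R i ∈ B) ∧
        ∀ (τ : localSubgroupOfEmb κ.kerSubgroup (closureEmb (K := ℚ) (v.adicCompletion ℚ))) (i : Fin r),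
          pointsMapOfEmb W (closureEmb (K := ℚ) (v.adicCompletion ℚ))
            ((Θ (φ.1 (resGalSubgroupOfEmb κ.kerSubgroup (closureEmb (K := ℚ) (v.adicCompletion ℚ)) τ)) i :
              ↥(W.geomPrimaryTorsion p)) : W.geomPoints) =
            (τ : absoluteGaloisGroup (v.adicCompletion ℚ)) • R i - R i := by
  obtain ⟨φ₀, R₀, hφ₀, hR₀, hloc₀⟩ :=
    exists_thetaKummerWitness_pushH1_of_layerLocOf_eq_thetaLayerKummer S ρ κ k W Θ v hΘ n b Q hkum
  -- one orbit: `σ = θ(d) · u` with `u ∈ Γ_∞`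
  obtain ⟨d, hd⟩ := hκ.exists_apply_resGalOfEmb_adicCompletion_eq v hv (κ σ)
  have hu : (resGalOfEmb (closureEmb (K := ℚ) (v.adicCompletion ℚ)) d)⁻¹ * σ ∈ κ.kerSubgroup := by
    rw [mem_kerSubgroup, map_mul, map_inv, hd, inv_mul_cancel]
  have hσ : σ = resGalOfEmb (closureEmb (K := ℚ) (v.adicCompletion ℚ)) d *
      ((resGalOfEmb (closureEmb (K := ℚ) (v.adicCompletion ℚ)) d)⁻¹ * σ) := by rw [mul_inv_cancel_left]
  refine ⟨conjCocycle κ.kerSubgroup (resGalOfEmb (closureEmb (K := ℚ) (v.adicCompletion ℚ)) d)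
      (contOneCocycles.pullback (subgroupInclusion (κ.kerSubgroup_le_layerSubgroup n))
        (resHomOfEquivariant (subgroupInclusion (κ.kerSubgroup_le_layerSubgroup n)) (AddMonoidHom.id _) fun _ _ ↦ rfl) φ₀),
    fun i ↦ d • R₀ i, k, ?_, fun i ↦ ?_, fun τ i ↦ ?_⟩
  · -- the class: `[conj_{θd} (φ₀|_{Γ_∞})] = conj_{θd} (res (push b)) = conj_{θd} conj_u (τ b) = conj_σ (τ b)`
    rw [← conjH1_oneCocycleClass, ← resOfLe_oneCocycleClass, hφ₀]
    conv_rhs => rw [hσ, Literature.NumberTheory.EllipticCurves.conjH1_mul_holds κ.kerSubgroup (Cofree ρ ↥(padicCoeffField S)),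
      AddMonoidHom.comp_apply, Literature.NumberTheory.EllipticCurves.conjH1_of_mem_holds κ.kerSubgroup
        (Cofree ρ ↥(padicCoeffField S)) hu, AddMonoidHom.id_apply]
    rfl
  · -- `p^k (d • R₀_i) = d • Q_i ∈ B`
    rw [smul_comm, hR₀ i]
    exact hB d _ (hQB i)
  · -- the Kummer identities: L-B over `Γ_∞` fed by L-C
    exact thetaKummerWitness_conj S ρ W Θ v hΘ κ.kerSubgroup d
      (thetaKummerWitness_resOfLe S ρ W Θ v (κ.kerSubgroup_le_layerSubgroup n) hloc₀) τ i

/-! ## §5 The PLUS/MINUS instance `B = ⨆_m E^ε(ℚ_{m,v})` — RSL_g's counted-set clause (3) for `y = transferH1 … b` -/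

omit [W.IsElliptic] in
/-- `⋃_m E^ε(ℚ_{m,v})` is `Γ_v`-stable (each `E^ε(ℚ_{m,v})` is: the layer traces are `Γ_v`-equivariant, TP2
`smul_mem_signedLocalPointsOfEmb`). [cite: Kobayashi2003, Def. 1.1] -/
theorem smul_mem_iSup_signedLocalPoints (ε : ℤˣ) (δ : absoluteGaloisGroup (v.adicCompletion ℚ))
    {a : localPoints W (v.adicCompletion ℚ)} (ha : a ∈ ⨆ m : ℕ, signedLocalPoints κ (v.adicCompletion ℚ) W ε m) :
    δ • a ∈ ⨆ m : ℕ, signedLocalPoints κ (v.adicCompletion ℚ) W ε m := by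
  refine AddSubgroup.iSup_induction (fun m : ℕ ↦ signedLocalPoints κ (v.adicCompletion ℚ) W ε m)
    (C := fun a ↦ δ • a ∈ ⨆ m : ℕ, signedLocalPoints κ (v.adicCompletion ℚ) W ε m) ha (fun m a ha ↦ ?_) ?_ ?_
  · exact AddSubgroup.mem_iSup_of_mem m (smul_mem_signedLocalPointsOfEmb κ _ W ε m δ ha)
  · rw [smul_zero]; exact zero_mem _
  · intro a b ha hb
    rw [smul_add]; exact add_mem ha hb

include hΘ in
/-- **T3♮-signed (RSL_g clause (3) shape).**  Under `[kum]` with `Q ∈ E^ε(ℚ_{n,v})^r`, every conjugate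
`conj_σ (transferH1 … b)` satisfies, at the place `v ∣ p`, the Θ-read signed Kummer condition with target
`⨆_m E^ε(ℚ_{m,v})`: the literal shape of clause (3) of the counted set of `ResidualSignedLambdaLowerCMAtTwo`
(there: `p = 2`, `ε = 1`, `Θ := Θ v hv`, `r = n`).  Nothing about RSL_g itself is proved. [cite: Kobayashi2003, Def. 1.1, §2 (p. 4)]
[cite: Washington1997, §13.1] [cite: Greenberg1989, §1 p. 98] -/
theorem exists_signedThetaKummerWitness_conjH1_transferH1 (hκ : κ.IsCyclotomic) (hv : (p : 𝓞 ℚ) ∈ v.asIdeal)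
    (ε : ℤˣ) (n : ℕ)
    (b : subgroupH1 (κ.layerSubgroup n) ↥(AddSubgroup.torsionBy (Cofree ρ ↥(padicCoeffField S)) ((p ^ k : ℕ) : ℤ)))
    (Q : Fin r → ↥(localLayerPointsOfEmb κ (closureEmb (K := ℚ) (v.adicCompletion ℚ)) W n))
    (hQ : ∀ i, ((Q i : ↥(localLayerPointsOfEmb κ (closureEmb (K := ℚ) (v.adicCompletion ℚ)) W n)) :
      localPoints W (v.adicCompletion ℚ)) ∈ signedLocalPointsOfEmb κ (closureEmb (K := ℚ) (v.adicCompletion ℚ)) W ε n)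
    (hkum : layerLocOf (cofreeTorsionGaloisModule S ρ ((p ^ k : ℕ) : ℤ)) κ v n b =
      thetaLayerKummer S ρ k W Θ κ v hΘ n Q)
    (σ : absoluteGaloisGroup ℚ) :
    ∃ (φ : contOneCocycles (discreteTopRep κ.kerSubgroup (Cofree ρ ↥(padicCoeffField S))))
      (R : Fin r → localPoints W (v.adicCompletion ℚ)) (k' : ℕ),
      oneCocycleClass (discreteTopRep κ.kerSubgroup (Cofree ρ ↥(padicCoeffField S))) φ =
          conjH1 κ.kerSubgroup (Cofree ρ ↥(padicCoeffField S)) σ (transferH1 S ρ κ ((p ^ k : ℕ) : ℤ) n b) ∧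
        (∀ i, (p ^ k') • R i ∈ ⨆ m : ℕ, signedLocalPoints κ (v.adicCompletion ℚ) W ε m) ∧
        ∀ τ i, pointsMapOfEmb W (closureEmb (K := ℚ) (v.adicCompletion ℚ))
            (((Θ (φ.1 (resGalSubgroupOfEmb κ.kerSubgroup (closureEmb (K := ℚ) (v.adicCompletion ℚ)) τ))) i :
              ↥(W.geomPrimaryTorsion p)) : W.geomPoints) =
            (τ : absoluteGaloisGroup (v.adicCompletion ℚ)) • R i - R i :=
  exists_thetaKummerWitness_conjH1_transferH1 S ρ κ k W Θ v hΘ hκ hv n b Q hkum _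
    (fun δ _ ha ↦ smul_mem_iSup_signedLocalPoints κ W v ε δ ha)
    (fun i ↦ AddSubgroup.mem_iSup_of_mem n (hQ i)) σ


/-! ## §6 [kum] is OUTPUT, not input: the double-annihilator clause of the one-place character lift, read back to the layer

In the S4₂ socket (ρ-twin of TP2 `levelwisePoitouTate_of_transfer`) the local condition at `v ∣ p` is typed `𝓕_v := C^⊥` with
`C := T_v (layerShapiroOf (thetaLayerKummer (E⁺_n)^r))` a subgroup of the LOCAL DUAL classes; the generic lift
`LocalInvariants.SelmerComplement.exists_selmer_localTatePairing_eq_of_subgroup` then hands every dual Selmer class `y` WITH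
`hy : loc_v y ∈ C` (double annihilator `C^⊥⊥ = C`, `mem_of_forall_annihilator_eq_zero`, inside its proof). The two theorems below turn
`loc_v (H¹(Ψ)(Sh b)) = T_v t` into `layerShapiroOf (layerLocOf b) = t` (perfectness of THE canonical local pairing on
`Maps(Γ_ℚ ⧸ Γ_n, M)`, through the landed `ρM`-generic dictionary `ThetaTransport.CoindShapiroOfFun` §1–§3) and then into
`layerLocOf b = c` (Shapiro injective). Generic finite coefficient module `M` with a non-degenerate pairing `e` — the LEAD pins
`M := A_ρ[2^k]`, `e := ePk k`. -/

section SocketReadback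

variable {M : Type} [AddCommGroup M] [TopologicalSpace M] [DiscreteTopology M]
  (ρM : DiscreteGaloisModule ℚ M) (N : ℕ) [NeZero N]
  (e : M → M → AlgebraicClosure ℚ)
  (hμ : ∀ S T, e S T ^ N = 1)
  (hadd₁ : ∀ S₁ S₂ T, e (S₁ + S₂) T = e S₁ T * e S₂ T)
  (hadd₂ : ∀ S T₁ T₂, e S (T₁ + T₂) = e S T₁ * e S T₂)
  (hgal : ∀ (σ : absoluteGaloisGroup ℚ) (S T : M), σ • e S T = e (ρM σ S) (ρM σ T))

/-- **Socket readback, Shapiro model.** If the localisation at `v ∣ p` of the dual-side global class `H¹(Ψ)(Sh b)` is the dual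
transport `T_v t` of a local layer-model class `t` (this is what `loc_v y ∈ C` says for `y = H¹(Ψ)(Sh b)`), then
`layerShapiroOf (layerLocOf b) = t`: both sides have the same local Tate pairing character
(`localTatePairingZMod_canonical_localization_coindTateDual_shapiroLift` vs. the defining property of `T_v`), and the layer pairing
at `v ∣ p` is non-degenerate (`eq_zero_of_forall_invAt_cupProduct_pull_eq_zero`, from `LocalInvariants.canonical_isPerfect`).
[cite: MilneADT2006, Ch. I Cor. 2.3, Thm. 4.10(b)] [cite: NeukirchSchmidtWingberg2008, I §6 Prop. (1.6.4), (1.6.5)]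
[cite: Kobayashi2003, (8.23) (p. 18)] -/
theorem layerShapiroOf_layerLocOf_eq_of_localization_eq_dualTransport [Finite M] [CompactSpace (absoluteGaloisGroup ℚ)]
    [CompactSpace (absoluteGaloisGroup (v.adicCompletion ℚ))] (hκ : κ.IsCyclotomic) (hv : (p : 𝓞 ℚ) ∈ v.asIdeal)
    (hnondeg : ∀ T, (∀ S, e S T = 1) → T = 0) (hN : ∀ m : M, N • m = 0) (n : ℕ)
    [Fintype (absoluteGaloisGroup ℚ ⧸ κ.layerSubgroup n)]
    {s : absoluteGaloisGroup ℚ ⧸ κ.layerSubgroup n → absoluteGaloisGroup ℚ}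
    (hs : ∀ y, (s y : absoluteGaloisGroup ℚ ⧸ κ.layerSubgroup n) = y)
    (hs1 : s ((1 : absoluteGaloisGroup ℚ) : absoluteGaloisGroup ℚ ⧸ κ.layerSubgroup n) = 1)
    (T : continuousCohomology.{0, 0, 0} 1 (coindFin.{0, 0} (localRepOf ρM v) (layerGroup κ v n)) →+
        galoisCohomology ((((ρM.coind (κ.layerSubgroup n) (κ.isOpen_layerSubgroup n)).tateDual N).toLocal (Sum.inr v))) 1)
    (hT : ∀ (t : continuousCohomology.{0, 0, 0} 1 (coindFin.{0, 0} (localRepOf ρM v) (layerGroup κ v n)))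
        (a' : galoisCohomology ((ρM.coind (κ.layerSubgroup n) (κ.isOpen_layerSubgroup n)).toLocal (Sum.inr v)) 1),
        localTatePairingZMod (ρM.coind (κ.layerSubgroup n) (κ.isOpen_layerSubgroup n)) N (Sum.inr v)
            (LocalInvariants.canonical ℚ N (Sum.inr v)) a' (T t) =
          invAt N v ((layerSumPairingOf ρM N e hμ hadd₁ hadd₂ hgal κ v n).cupProduct
            (cohomologyMap (coindFinPull ρM.toTopRep (κ.layerSubgroup n)
              (resGalOfEmb (closureEmb (K := ℚ) (v.adicCompletion ℚ))) (X' := localRepOf ρM v)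
              (TopRep.ofHom ⟨ContinuousLinearMap.id ℤ M, fun _ => rfl⟩) (layerGroup κ v n) (fun _ h => h)) 1 a')
            t))
    (b : H1 ρM (κ.layerSubgroup n))
    (t : continuousCohomology.{0, 0, 0} 1 (coindFin.{0, 0} (localRepOf ρM v) (layerGroup κ v n)))
    (hC : galoisCohomology.localization ((ρM.coind (κ.layerSubgroup n) (κ.isOpen_layerSubgroup n)).tateDual N) (Sum.inr v) 1
          (cohomologyMap (coindTateDualMor ρM ρM (κ.layerSubgroup n) (pairingHomOfFun N e hμ hadd₁ hadd₂) (κ.isOpen_layerSubgroup n)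
              (fun σ S T => (contPairingOfFun ρM N e hμ hadd₁ hadd₂ hgal).toLin_smul σ S T)) 1
            (shapiroLift ρM.toTopRep (κ.layerSubgroup n) (κ.isOpen_layerSubgroup n) hs hs1 b)) = T t) :
    layerShapiroOf ρM κ v n (layerLocOf ρM κ v n b) = t := by
  rw [← sub_eq_zero]
  refine ThetaTransport.CoindShapiroOfFun.eq_zero_of_forall_invAt_cupProduct_pull_eq_zero ρM N e hμ hadd₁ hadd₂ hgal κ v hκ hv
    hnondeg hN n _ fun a' => ?_
  rw [map_sub, map_sub, ← hT t a', ← hC,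
    ThetaTransport.CoindShapiroOfFun.localTatePairingZMod_canonical_localization_coindTateDual_shapiroLift ρM N e hμ hadd₁ hadd₂
      hgal κ v hκ hv n hs hs1 a' b, sub_self]

/-- **Socket readback, layer currency**: with `t = layerShapiroOf c` the previous theorem and the injectivity of the layer Shapiro
map (`shapiroLift_injective`) give `layerLocOf b = c` — for `c := thetaLayerKummer … Q` this is LITERALLY the hypothesis `[kum]_n`
of the Kummer-witness transport T3♮ (§1/§4/§5 below = k3·g14 `exists_thetaKummerWitness_pushH1`, file B of Q79).
[cite: NeukirchSchmidtWingberg2008, I §6 Prop. (1.6.4)] [cite: MilneADT2006, Ch. I Cor. 2.3] -/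
theorem layerLocOf_eq_of_localization_eq_dualTransport [Finite M] [CompactSpace (absoluteGaloisGroup ℚ)]
    [CompactSpace (absoluteGaloisGroup (v.adicCompletion ℚ))] (hκ : κ.IsCyclotomic) (hv : (p : 𝓞 ℚ) ∈ v.asIdeal)
    (hnondeg : ∀ T, (∀ S, e S T = 1) → T = 0) (hN : ∀ m : M, N • m = 0) (n : ℕ)
    [Fintype (absoluteGaloisGroup ℚ ⧸ κ.layerSubgroup n)]
    {s : absoluteGaloisGroup ℚ ⧸ κ.layerSubgroup n → absoluteGaloisGroup ℚ}
    (hs : ∀ y, (s y : absoluteGaloisGroup ℚ ⧸ κ.layerSubgroup n) = y)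
    (hs1 : s ((1 : absoluteGaloisGroup ℚ) : absoluteGaloisGroup ℚ ⧸ κ.layerSubgroup n) = 1)
    (T : continuousCohomology.{0, 0, 0} 1 (coindFin.{0, 0} (localRepOf ρM v) (layerGroup κ v n)) →+
        galoisCohomology ((((ρM.coind (κ.layerSubgroup n) (κ.isOpen_layerSubgroup n)).tateDual N).toLocal (Sum.inr v))) 1)
    (hT : ∀ (t : continuousCohomology.{0, 0, 0} 1 (coindFin.{0, 0} (localRepOf ρM v) (layerGroup κ v n)))
        (a' : galoisCohomology ((ρM.coind (κ.layerSubgroup n) (κ.isOpen_layerSubgroup n)).toLocal (Sum.inr v)) 1),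
        localTatePairingZMod (ρM.coind (κ.layerSubgroup n) (κ.isOpen_layerSubgroup n)) N (Sum.inr v)
            (LocalInvariants.canonical ℚ N (Sum.inr v)) a' (T t) =
          invAt N v ((layerSumPairingOf ρM N e hμ hadd₁ hadd₂ hgal κ v n).cupProduct
            (cohomologyMap (coindFinPull ρM.toTopRep (κ.layerSubgroup n)
              (resGalOfEmb (closureEmb (K := ℚ) (v.adicCompletion ℚ))) (X' := localRepOf ρM v)
              (TopRep.ofHom ⟨ContinuousLinearMap.id ℤ M, fun _ => rfl⟩) (layerGroup κ v n) (fun _ h => h)) 1 a')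
            t))
    (b : H1 ρM (κ.layerSubgroup n))
    (c : continuousCohomology 1 (subgroupRep (localRepOf ρM v) (layerGroup κ v n)))
    (hC : galoisCohomology.localization ((ρM.coind (κ.layerSubgroup n) (κ.isOpen_layerSubgroup n)).tateDual N) (Sum.inr v) 1
          (cohomologyMap (coindTateDualMor ρM ρM (κ.layerSubgroup n) (pairingHomOfFun N e hμ hadd₁ hadd₂) (κ.isOpen_layerSubgroup n)
              (fun σ S T => (contPairingOfFun ρM N e hμ hadd₁ hadd₂ hgal).toLin_smul σ S T)) 1
            (shapiroLift ρM.toTopRep (κ.layerSubgroup n) (κ.isOpen_layerSubgroup n) hs hs1 b)) =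
          T (layerShapiroOf ρM κ v n c)) :
    layerLocOf ρM κ v n b = c := by
  have h := layerShapiroOf_layerLocOf_eq_of_localization_eq_dualTransport κ v ρM N e hμ hadd₁ hadd₂ hgal hκ hv hnondeg hN n hs hs1
    T hT b (layerShapiroOf ρM κ v n c) hC
  unfold layerShapiroOf at h
  exact shapiroLift_injective (localRepOf ρM v) (layerGroup κ v n) (isOpen_layerGroup κ v n) (layerReps_spec κ v n)
    (layerReps_one κ v n) h

end SocketReadback

/-! ## §7 The dual-side dictionary of S4₂ at `v ∣ p`, Kummer part: `loc_v y ∈ C` ⟹ `y = H¹(Ψ)(Sh b)` with `[kum]_n` for PLUS points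

`C` is any set of local dual classes contained in the `T_v ∘ layerShapiroOf ∘ thetaLayerKummer`-image of a set `B` of tuples of layer
points (the LEAD takes `B := (E⁺(ℚ_{n,v}))^r` and `C :=` the range); conclusion: the unique layer class `b` under `y`
(`existsUnique_shapiroLift_coindTateDual_eq`) satisfies `layerLocOf b = thetaLayerKummer Q` with `Q ∈ B` — the `[kum]_n` input of T3♮,
PRODUCED by duality. Coefficients `M := A_ρ[p^k]` (`cofreeTorsionGaloisModule`), pairing `e` still generic (pinned by the LEAD). -/

section DualDictionary

variable (e : ↥(AddSubgroup.torsionBy (Cofree ρ ↥(padicCoeffField S)) ((p ^ k : ℕ) : ℤ)) →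
    ↥(AddSubgroup.torsionBy (Cofree ρ ↥(padicCoeffField S)) ((p ^ k : ℕ) : ℤ)) → AlgebraicClosure ℚ)
  (hμ : ∀ S' T, e S' T ^ (p ^ k) = 1)
  (hadd₁ : ∀ S₁ S₂ T, e (S₁ + S₂) T = e S₁ T * e S₂ T)
  (hadd₂ : ∀ S' T₁ T₂, e S' (T₁ + T₂) = e S' T₁ * e S' T₂)
  (hgal : ∀ (σ : absoluteGaloisGroup ℚ) (S' T : ↥(AddSubgroup.torsionBy (Cofree ρ ↥(padicCoeffField S)) ((p ^ k : ℕ) : ℤ))),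
    σ • e S' T = e (cofreeTorsionGaloisModule S ρ ((p ^ k : ℕ) : ℤ) σ S') (cofreeTorsionGaloisModule S ρ ((p ^ k : ℕ) : ℤ) σ T))

include hΘ in
/-- **`hdictT` at `v ∣ p`, Kummer part.** For a dual-side global class `y ∈ H¹(ℚ, Maps(Γ_ℚ ⧸ Γ_n, A_ρ[p^k])^D)` whose localisation at
`v` lies in a set `C` of dual transports of Θ-Kummer classes of tuples from `B`: `y = H¹(Ψ)(Sh b)` for a layer class `b` with
`layerLocOf b = thetaLayerKummer Q`, `Q ∈ B`. With `B := (E⁺_n)^r` this is the `[kum]_n` input of the PLUS-Kummer witness transport;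
no «points^⊥ = points» self-duality of the signed points is used anywhere — the double annihilator lives on the finite local groups of
`Maps(Γ_ℚ ⧸ Γ_n, A_ρ[p^k])`, inside the generic lift. [cite: MilneADT2006, Ch. I Cor. 2.3, Thm. 4.10(b)]
[cite: Kobayashi2003, Def. 1.1, (8.23) (p. 18)] [cite: NeukirchSchmidtWingberg2008, I §6 Prop. (1.6.4), (1.6.5)] -/
theorem exists_shapiroLift_eq_and_layerLocOf_eq_thetaLayerKummer
    [Finite ↥(AddSubgroup.torsionBy (Cofree ρ ↥(padicCoeffField S)) ((p ^ k : ℕ) : ℤ))] [CompactSpace (absoluteGaloisGroup ℚ)]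
    [CompactSpace (absoluteGaloisGroup (v.adicCompletion ℚ))] [NeZero (p ^ k)] (hκ : κ.IsCyclotomic) (hv : (p : 𝓞 ℚ) ∈ v.asIdeal)
    (hnondeg : ∀ T, (∀ S', e S' T = 1) → T = 0)
    (hN : ∀ m : ↥(AddSubgroup.torsionBy (Cofree ρ ↥(padicCoeffField S)) ((p ^ k : ℕ) : ℤ)), (p ^ k) • m = 0) (n : ℕ)
    [Fintype (absoluteGaloisGroup ℚ ⧸ κ.layerSubgroup n)]
    {s : absoluteGaloisGroup ℚ ⧸ κ.layerSubgroup n → absoluteGaloisGroup ℚ}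
    (hs : ∀ y, (s y : absoluteGaloisGroup ℚ ⧸ κ.layerSubgroup n) = y)
    (hs1 : s ((1 : absoluteGaloisGroup ℚ) : absoluteGaloisGroup ℚ ⧸ κ.layerSubgroup n) = 1)
    (T : continuousCohomology.{0, 0, 0} 1
          (coindFin.{0, 0} (localRepOf (cofreeTorsionGaloisModule S ρ ((p ^ k : ℕ) : ℤ)) v) (layerGroup κ v n)) →+
        galoisCohomology (((((cofreeTorsionGaloisModule S ρ ((p ^ k : ℕ) : ℤ)).coind (κ.layerSubgroup n)
          (κ.isOpen_layerSubgroup n)).tateDual (p ^ k)).toLocal (Sum.inr v))) 1)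
    (hT : ∀ (t : continuousCohomology.{0, 0, 0} 1
          (coindFin.{0, 0} (localRepOf (cofreeTorsionGaloisModule S ρ ((p ^ k : ℕ) : ℤ)) v) (layerGroup κ v n)))
        (a' : galoisCohomology (((cofreeTorsionGaloisModule S ρ ((p ^ k : ℕ) : ℤ)).coind (κ.layerSubgroup n)
          (κ.isOpen_layerSubgroup n)).toLocal (Sum.inr v)) 1),
        localTatePairingZMod ((cofreeTorsionGaloisModule S ρ ((p ^ k : ℕ) : ℤ)).coind (κ.layerSubgroup n)
              (κ.isOpen_layerSubgroup n)) (p ^ k) (Sum.inr v) (LocalInvariants.canonical ℚ (p ^ k) (Sum.inr v)) a' (T t) =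
          invAt (p ^ k) v ((layerSumPairingOf (cofreeTorsionGaloisModule S ρ ((p ^ k : ℕ) : ℤ)) (p ^ k) e hμ hadd₁ hadd₂ hgal
              κ v n).cupProduct
            (cohomologyMap (coindFinPull (cofreeTorsionGaloisModule S ρ ((p ^ k : ℕ) : ℤ)).toTopRep (κ.layerSubgroup n)
              (resGalOfEmb (closureEmb (K := ℚ) (v.adicCompletion ℚ)))
              (X' := localRepOf (cofreeTorsionGaloisModule S ρ ((p ^ k : ℕ) : ℤ)) v)
              (TopRep.ofHom ⟨ContinuousLinearMap.id ℤ _, fun _ => rfl⟩) (layerGroup κ v n) (fun _ h => h)) 1 a')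
            t))
    (B : Set (Fin r → localLayerPointsOfEmb κ (closureEmb (K := ℚ) (v.adicCompletion ℚ)) W n))
    (C : Set (galoisCohomology (((((cofreeTorsionGaloisModule S ρ ((p ^ k : ℕ) : ℤ)).coind (κ.layerSubgroup n)
          (κ.isOpen_layerSubgroup n)).tateDual (p ^ k)).toLocal (Sum.inr v))) 1))
    (hCB : ∀ c ∈ C, ∃ Q ∈ B,
      c = T (layerShapiroOf (cofreeTorsionGaloisModule S ρ ((p ^ k : ℕ) : ℤ)) κ v n (thetaLayerKummer S ρ k W Θ κ v hΘ n Q)))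
    (y : galoisCohomology (((cofreeTorsionGaloisModule S ρ ((p ^ k : ℕ) : ℤ)).coind (κ.layerSubgroup n)
          (κ.isOpen_layerSubgroup n)).tateDual (p ^ k)) 1)
    (hy : galoisCohomology.localization (((cofreeTorsionGaloisModule S ρ ((p ^ k : ℕ) : ℤ)).coind (κ.layerSubgroup n)
          (κ.isOpen_layerSubgroup n)).tateDual (p ^ k)) (Sum.inr v) 1 y ∈ C) :
    ∃ (b : H1 (cofreeTorsionGaloisModule S ρ ((p ^ k : ℕ) : ℤ)) (κ.layerSubgroup n))
      (Q : Fin r → localLayerPointsOfEmb κ (closureEmb (K := ℚ) (v.adicCompletion ℚ)) W n),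
      cohomologyMap (coindTateDualMor (cofreeTorsionGaloisModule S ρ ((p ^ k : ℕ) : ℤ))
            (cofreeTorsionGaloisModule S ρ ((p ^ k : ℕ) : ℤ)) (κ.layerSubgroup n) (pairingHomOfFun (p ^ k) e hμ hadd₁ hadd₂)
            (κ.isOpen_layerSubgroup n)
            (fun σ S' T' => (contPairingOfFun (cofreeTorsionGaloisModule S ρ ((p ^ k : ℕ) : ℤ)) (p ^ k) e hμ hadd₁ hadd₂
              hgal).toLin_smul σ S' T')) 1
          (shapiroLift (cofreeTorsionGaloisModule S ρ ((p ^ k : ℕ) : ℤ)).toTopRep (κ.layerSubgroup n)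
            (κ.isOpen_layerSubgroup n) hs hs1 b) = y ∧
      Q ∈ B ∧
      layerLocOf (cofreeTorsionGaloisModule S ρ ((p ^ k : ℕ) : ℤ)) κ v n b = thetaLayerKummer S ρ k W Θ κ v hΘ n Q := by
  obtain ⟨b, hb, -⟩ :=
    ThetaTransport.CoindShapiroOfFun.existsUnique_shapiroLift_coindTateDual_eq (cofreeTorsionGaloisModule S ρ ((p ^ k : ℕ) : ℤ))
      (p ^ k) e hμ hadd₁ hadd₂ hgal κ hnondeg hN n hs hs1 y
  obtain ⟨Q, hQB, hc⟩ := hCB _ hy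
  refine ⟨b, Q, hb, hQB, ?_⟩
  refine layerLocOf_eq_of_localization_eq_dualTransport κ v (cofreeTorsionGaloisModule S ρ ((p ^ k : ℕ) : ℤ)) (p ^ k) e hμ hadd₁
    hadd₂ hgal hκ hv hnondeg hN n hs hs1 T hT b (thetaLayerKummer S ρ k W Θ κ v hΘ n Q) ?_
  rw [hb]
  exact hc

end DualDictionary


/-! ## §8 End to end at `v ∣ p`: the socket's double-annihilator clause ⟹ RSL_g's clause (3) (signed, every `σ`) for `transferH1 b`

Composition §7 ∘ §5: from `loc_v y ∈ C` (with `C` inside the dual transport of the Θ-Kummer classes of SIGNED tuples) to the signed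
Θ-Kummer witness of every conjugate of `transferH1 … b`, `y = H¹(Ψ)(Sh b)`. This is the `v ∣ 2` field of the dual-side dictionary `hdictT`
(`MackeyPackage.levelwise_exists_of_selmerComplement_oneOrbit`) for S4₂, in kernel; the other fields (unramified outside `S`, `infKer`,
relaxed/strict away from 2) are k3·g13's T1/T2/T3 (`Theorems.ThetaTransport.CofreeSelmerTransfer`, landed). -/

section EndToEnd

variable (e : ↥(AddSubgroup.torsionBy (Cofree ρ ↥(padicCoeffField S)) ((p ^ k : ℕ) : ℤ)) →
    ↥(AddSubgroup.torsionBy (Cofree ρ ↥(padicCoeffField S)) ((p ^ k : ℕ) : ℤ)) → AlgebraicClosure ℚ)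
  (hμ : ∀ S' T, e S' T ^ (p ^ k) = 1)
  (hadd₁ : ∀ S₁ S₂ T, e (S₁ + S₂) T = e S₁ T * e S₂ T)
  (hadd₂ : ∀ S' T₁ T₂, e S' (T₁ + T₂) = e S' T₁ * e S' T₂)
  (hgal : ∀ (σ : absoluteGaloisGroup ℚ) (S' T : ↥(AddSubgroup.torsionBy (Cofree ρ ↥(padicCoeffField S)) ((p ^ k : ℕ) : ℤ))),
    σ • e S' T = e (cofreeTorsionGaloisModule S ρ ((p ^ k : ℕ) : ℤ) σ S') (cofreeTorsionGaloisModule S ρ ((p ^ k : ℕ) : ℤ) σ T))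

include hΘ in
/-- **Socket clause ⟹ clause (3).** [cite: MilneADT2006, Ch. I Cor. 2.3, Thm. 4.10(b)] [cite: Kobayashi2003, Def. 1.1, §2 (p. 4), (8.23) (p. 18)]
[cite: NeukirchSchmidtWingberg2008, I §6 Prop. (1.6.4)] [cite: Washington1997, §13.1] -/
theorem exists_signedThetaKummerWitness_conjH1_transferH1_of_localization_mem
    [Finite ↥(AddSubgroup.torsionBy (Cofree ρ ↥(padicCoeffField S)) ((p ^ k : ℕ) : ℤ))] [CompactSpace (absoluteGaloisGroup ℚ)]
    [CompactSpace (absoluteGaloisGroup (v.adicCompletion ℚ))] [NeZero (p ^ k)] (hκ : κ.IsCyclotomic) (hv : (p : 𝓞 ℚ) ∈ v.asIdeal)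
    (hnondeg : ∀ T, (∀ S', e S' T = 1) → T = 0)
    (hN : ∀ m : ↥(AddSubgroup.torsionBy (Cofree ρ ↥(padicCoeffField S)) ((p ^ k : ℕ) : ℤ)), (p ^ k) • m = 0) (ε : ℤˣ) (n : ℕ)
    [Fintype (absoluteGaloisGroup ℚ ⧸ κ.layerSubgroup n)]
    {s : absoluteGaloisGroup ℚ ⧸ κ.layerSubgroup n → absoluteGaloisGroup ℚ}
    (hs : ∀ y, (s y : absoluteGaloisGroup ℚ ⧸ κ.layerSubgroup n) = y)
    (hs1 : s ((1 : absoluteGaloisGroup ℚ) : absoluteGaloisGroup ℚ ⧸ κ.layerSubgroup n) = 1)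
    (T : continuousCohomology.{0, 0, 0} 1
          (coindFin.{0, 0} (localRepOf (cofreeTorsionGaloisModule S ρ ((p ^ k : ℕ) : ℤ)) v) (layerGroup κ v n)) →+
        galoisCohomology (((((cofreeTorsionGaloisModule S ρ ((p ^ k : ℕ) : ℤ)).coind (κ.layerSubgroup n)
          (κ.isOpen_layerSubgroup n)).tateDual (p ^ k)).toLocal (Sum.inr v))) 1)
    (hT : ∀ (t : continuousCohomology.{0, 0, 0} 1
          (coindFin.{0, 0} (localRepOf (cofreeTorsionGaloisModule S ρ ((p ^ k : ℕ) : ℤ)) v) (layerGroup κ v n)))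
        (a' : galoisCohomology (((cofreeTorsionGaloisModule S ρ ((p ^ k : ℕ) : ℤ)).coind (κ.layerSubgroup n)
          (κ.isOpen_layerSubgroup n)).toLocal (Sum.inr v)) 1),
        localTatePairingZMod ((cofreeTorsionGaloisModule S ρ ((p ^ k : ℕ) : ℤ)).coind (κ.layerSubgroup n)
              (κ.isOpen_layerSubgroup n)) (p ^ k) (Sum.inr v) (LocalInvariants.canonical ℚ (p ^ k) (Sum.inr v)) a' (T t) =
          invAt (p ^ k) v ((layerSumPairingOf (cofreeTorsionGaloisModule S ρ ((p ^ k : ℕ) : ℤ)) (p ^ k) e hμ hadd₁ hadd₂ hgal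
              κ v n).cupProduct
            (cohomologyMap (coindFinPull (cofreeTorsionGaloisModule S ρ ((p ^ k : ℕ) : ℤ)).toTopRep (κ.layerSubgroup n)
              (resGalOfEmb (closureEmb (K := ℚ) (v.adicCompletion ℚ)))
              (X' := localRepOf (cofreeTorsionGaloisModule S ρ ((p ^ k : ℕ) : ℤ)) v)
              (TopRep.ofHom ⟨ContinuousLinearMap.id ℤ _, fun _ => rfl⟩) (layerGroup κ v n) (fun _ h => h)) 1 a')
            t))
    (C : Set (galoisCohomology (((((cofreeTorsionGaloisModule S ρ ((p ^ k : ℕ) : ℤ)).coind (κ.layerSubgroup n)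
          (κ.isOpen_layerSubgroup n)).tateDual (p ^ k)).toLocal (Sum.inr v))) 1))
    (hCB : ∀ c ∈ C, ∃ Q : Fin r → localLayerPointsOfEmb κ (closureEmb (K := ℚ) (v.adicCompletion ℚ)) W n,
      (∀ i, ((Q i : ↥(localLayerPointsOfEmb κ (closureEmb (K := ℚ) (v.adicCompletion ℚ)) W n)) :
          localPoints W (v.adicCompletion ℚ)) ∈ signedLocalPointsOfEmb κ (closureEmb (K := ℚ) (v.adicCompletion ℚ)) W ε n) ∧
      c = T (layerShapiroOf (cofreeTorsionGaloisModule S ρ ((p ^ k : ℕ) : ℤ)) κ v n (thetaLayerKummer S ρ k W Θ κ v hΘ n Q)))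
    (y : galoisCohomology (((cofreeTorsionGaloisModule S ρ ((p ^ k : ℕ) : ℤ)).coind (κ.layerSubgroup n)
          (κ.isOpen_layerSubgroup n)).tateDual (p ^ k)) 1)
    (hy : galoisCohomology.localization (((cofreeTorsionGaloisModule S ρ ((p ^ k : ℕ) : ℤ)).coind (κ.layerSubgroup n)
          (κ.isOpen_layerSubgroup n)).tateDual (p ^ k)) (Sum.inr v) 1 y ∈ C)
    (σ : absoluteGaloisGroup ℚ) :
    ∃ b : H1 (cofreeTorsionGaloisModule S ρ ((p ^ k : ℕ) : ℤ)) (κ.layerSubgroup n),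
      cohomologyMap (coindTateDualMor (cofreeTorsionGaloisModule S ρ ((p ^ k : ℕ) : ℤ))
            (cofreeTorsionGaloisModule S ρ ((p ^ k : ℕ) : ℤ)) (κ.layerSubgroup n) (pairingHomOfFun (p ^ k) e hμ hadd₁ hadd₂)
            (κ.isOpen_layerSubgroup n)
            (fun σ' S' T' => (contPairingOfFun (cofreeTorsionGaloisModule S ρ ((p ^ k : ℕ) : ℤ)) (p ^ k) e hμ hadd₁ hadd₂
              hgal).toLin_smul σ' S' T')) 1
          (shapiroLift (cofreeTorsionGaloisModule S ρ ((p ^ k : ℕ) : ℤ)).toTopRep (κ.layerSubgroup n)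
            (κ.isOpen_layerSubgroup n) hs hs1 b) = y ∧
      ∃ (φ : contOneCocycles (discreteTopRep κ.kerSubgroup (Cofree ρ ↥(padicCoeffField S))))
        (R : Fin r → localPoints W (v.adicCompletion ℚ)) (k' : ℕ),
        oneCocycleClass (discreteTopRep κ.kerSubgroup (Cofree ρ ↥(padicCoeffField S))) φ =
            conjH1 κ.kerSubgroup (Cofree ρ ↥(padicCoeffField S)) σ (transferH1 S ρ κ ((p ^ k : ℕ) : ℤ) n b) ∧
          (∀ i, (p ^ k') • R i ∈ ⨆ m : ℕ, signedLocalPoints κ (v.adicCompletion ℚ) W ε m) ∧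
          ∀ τ i, pointsMapOfEmb W (closureEmb (K := ℚ) (v.adicCompletion ℚ))
              (((Θ (φ.1 (resGalSubgroupOfEmb κ.kerSubgroup (closureEmb (K := ℚ) (v.adicCompletion ℚ)) τ))) i :
                ↥(W.geomPrimaryTorsion p)) : W.geomPoints) =
              (τ : absoluteGaloisGroup (v.adicCompletion ℚ)) • R i - R i := by
  obtain ⟨b, Q, hb, hQ, hkum⟩ :=
    exists_shapiroLift_eq_and_layerLocOf_eq_thetaLayerKummer S ρ κ k W Θ v hΘ e hμ hadd₁ hadd₂ hgal hκ hv hnondeg hN n hs hs1 T hT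
      {Q | ∀ i, ((Q i : ↥(localLayerPointsOfEmb κ (closureEmb (K := ℚ) (v.adicCompletion ℚ)) W n)) :
          localPoints W (v.adicCompletion ℚ)) ∈ signedLocalPointsOfEmb κ (closureEmb (K := ℚ) (v.adicCompletion ℚ)) W ε n}
      C (fun c hc => by obtain ⟨Q, hQ, h⟩ := hCB c hc; exact ⟨Q, hQ, h⟩) y hy
  exact ⟨b, hb, exists_signedThetaKummerWitness_conjH1_transferH1 S ρ κ k W Θ v hΘ hκ hv ε n b Q hQ hkum σ⟩

end EndToEnd

end Summit.BirchSwinnertonDyer.BirchSwinnertonDyer.Cruxes.ResidualThetaCountLowerPureAtTwo.StubIdeasK2G15
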